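import Mathlib
import Literature.Analysis.FluidPDE.ClassicalSolution
import Literature.Analysis.FluidPDE.VectorCalculus
import Literature.Analysis.FluidPDE.Vorticity
import Literature.Analysis.FluidPDE.AxisymmetricEuler
import Summits.NavierStokesRegularity.NavierStokesRegularity.Theses.ThreadingFlux
import Summits.NavierStokesRegularity.NavierStokesRegularity.Theorems.ThreadingFluxCentreJetDefs
import Summits.NavierStokesRegularity.NavierStokesRegularity.Theorems.ThreadingFluxCentreJetFirstLemmas
import Summits.NavierStokesRegularity.NavierStokesRegularity.Theorems.ThreadingFluxCentreJetStrainLaw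
import Summits.NavierStokesRegularity.NavierStokesRegularity.Theorems.ThreadingFluxCentreJetVorticityJet
import Summits.NavierStokesRegularity.NavierStokesRegularity.Theorems.ThreadingFluxCentreJetDriftLaw
import Summits.NavierStokesRegularity.NavierStokesRegularity.Theorems.ThreadingFluxCentreJetDriftLawEvolution
import Summits.NavierStokesRegularity.NavierStokesRegularity.Theorems.ThreadingFluxCentreJetSteadySlaving
import Summits.NavierStokesRegularity.NavierStokesRegularity.Theorems.ThreadingFluxCentreJetPoloidalRepresentation
import Summits.NavierStokesRegularity.NavierStokesRegularity.Theorems.ThreadingFluxCentreJetRigidityReduction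
import Summits.NavierStokesRegularity.NavierStokesRegularity.Theorems.ThreadingFluxCentreJetSteadyFacts
import Summits.NavierStokesRegularity.NavierStokesRegularity.Theorems.ThreadingFluxCentreJetEulerTopIntegrals
import Summits.NavierStokesRegularity.NavierStokesRegularity.Theorems.ThreadingFluxCentreJetHarmonicPolhode
import Summits.NavierStokesRegularity.NavierStokesRegularity.Theorems.ThreadingFluxCentreJetRigidityReductionSharp

/-!
# CentreJet — the STEADY CENTRE-JET SIEVE (crux idea `steady-centre-sieve`, ns-idea-15 g5, lens «negation»)

Crux: `ThreadingFlux.PoloidalLiouville` (stmt-1222, wall W1 = `stub_scalarLiouville`), STEADY STRATUM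
(`Precession.SteadyPoloidalLiouvilleW1`, the residual core typed by g4: every threading coefficient of a steady
unthreaded flow vanishes identically, so no jet sieve IN TIME constrains it).  NS regularity is NOT proved here; nothing
below is claimed proved unless marked S (routine) — C marks a conjecture, R a reduction.

## The lever (new): sieve in SPACE at the centre, on the steady stratum the loop law is the whole theory
Unthreaded kinematics about `x₀` (`y := x − x₀`): `curl V = ∇T × y`, `V = T y + ∇φ`, `Δφ = −(3 + y·∇)T`, loop momentum
`m := ⟪V, y⟫ = r²T + y·∇φ`.  STEADY Navier–Stokes is then EQUIVALENT (formally at `x₀`, and for real-analytic germs) to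
  (L) the LOOP LAW `det(y, ∇T, ∇m) ≡ 0` (`= −⟪y, curl((V·∇)V)⟫`, g3's `LoopMomentumIdentity`), and
  (S) SLAVING `∇(ΔT) × y = curl(curl V × V)` (the steady vorticity equation; `Δ(∇T × y) = ∇(ΔT) × y`), which is solvable
      for `ΔT` IFF (L) holds (a divergence-free field is toroidal-exact `∇q × y` iff it is tangent to the spheres) and then
      determines `ΔT` up to radial gauge.
So the free Taylor data at the centre are the solid-harmonic parts `h_n ∈ 𝓗_n` of `T_n` and `γ_n ∈ 𝓗_n` of `φ_n`, and the
ONLY constraints are the homogeneous components `P_k = 0` of (L).  NORMAL FORM (centre of type N: `c := −½ΔV(x₀) ≠ 0`,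
axis `e₃ ∥ c`, drift `V(x₀) = β e₃` by `CentreDriftLaw`): the newest data enter `P_k` only through
`∂_ϕ(β h_k − k γ_k)`, whose image is exactly the non-zonal part of `𝓗_k`; hence at degree `k` the LOWER data must satisfy
`Δ P_k|_{σ_k = 0} = 0` — `k(k−1)/2` polynomial conditions — against `4k` new real freedoms, and zonal (axisymmetric) data
are never constrained.  EXACT ENGINE (pure-python rational arithmetic, `engine/steady_jet.py`, published with the card):
  k=1  `V(x₀) × ΔV(x₀) = 0`                                   (`CentreDriftLaw`, S, holds for every unthreaded EVOLUTION too)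
  k=2  `sym ∇V(x₀) − β·Q` is zonal about `c` (`Q` = quadratic toroidal potential, FREE incl. non-zonal)   (`CentreStrainLawAlgebra`)
  k=3  `(s₂ − 3β²/8) · Q_{m=±1} = 0`  (first STEADY-specific law: uses the slaved `T₃^{part} = (3β/10) r² ⟪Qe₃, y⟫`)
  k=4  modes `m = 1, 2` of `Q` are killed outright at the trivial base (`−16/5·Q₁ = 0`, `−64/5·Q₂ = 0`), absorbed by `h₃` iff `s₂ ≠ β²/3`
  LINEARISED SIEVE about an axisymmetric base jet, exact rank over ℚ: through degree K = 6 and K = 8, at random rational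
  bases (2 seeds) AND on the special strata {trivial, pure drift, tilt `s₂ = 3β²/8`, absorber-degenerate `s₂ = β²/3`, no
  drift}: every non-zonal datum of mode `m ≤ K − 4` and degree `≤ K − 1` is FORCED TO ZERO ("mode m dies by degree m+4");
  the zonal `𝓗_k`-coefficient of `P_k` vanishes identically (k ≤ 8); `m = 0` conditions are quadratic in non-zonal data and
  start at k = 5.  WINDOW LEMMA: if the lowest non-zonal degree is `n₀ ≥ 6`, all its modes die inside the range
  `k ≤ 2n₀ − 2` where the true conditions ARE the linearised ones ⇒ contradiction; so NON-AXISYMMETRY OF A TYPE-N STEADY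
  UNTHREADED GERM IS VISIBLE IN ITS 5-JET (modulo the all-base linear kill lemma) — the negation record says where a steady
  counterexample must differ from every axisymmetric flow.
NEGATION RECORD (where a counterexample germ can still live): (a) type-N centres with a NON-PERTURBATIVE non-zonal 5-jet
(pure quadrupole seed `Q_{m=2}` is unobstructed through degree 5 by count; decided by a finite elimination at degrees 8–9,
kit-sized); (b) DEGENERATE centres `ΔV(x₀) = 0`: at a pure-strain stagnation centre (`V(x₀) = 0`, `curl curl V(x₀) = 0`,
`sym∇V(x₀) = S` generic) the formal family `T₂ = λ·⟪y, Sy⟫` (vorticity `2λ Sy × y`, NOT axisymmetric) passes the sieve through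
degree 5 (`curl(ω₂ × v₁) = ∇(2λ⟪y,S²y⟫) × y` is toroidal-exact) — so LOCAL rigidity is only conjectured at type-N centres, and
the global steady stratum splits as `NoTypeNCentre` (below, ⇐ `SteadyLocalRigidityN` + KNSS) + the degenerate-centre case
(v1.1/v1.3: its triaxial pure-strain piece is `NoTriaxialPolhodeCentre` (C1″), engine-obstructed at degree 11;
v1.2: the unified linearised sieve is gauge-exact at every centre type ⇒ master conjecture `SteadyLocalRigidity` (C1*) and
the full conditional closure `SteadyStratumOfRigidity : C1* → R3 → SteadyUnthreadedLiouville`).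
STATUS v1.5 (ns-idea-15 g7, 2026-08-29: + A2, R2♮, R2♮-N by name; C1* = the only open input of the steady stratum). v1.4 (g6): KERNEL by name — E1, E2, E2′, E3, E4, E5, R3, sanity, F2, G1, R2, R2*, A1; hence
`steadyUnthreadedLiouville_of' : SteadyNSAnalytic → SteadyLocalRigidity → SteadyUnthreadedLiouville` (the steady stratum
of W1 reduces to interior analyticity F1 + the conjecture C1*; eng-7's Sharp file removes F1 next).  OPEN: C1, C1*, C1″, A2,
L1 (paper-proved), F1 (literature-grade).  1222 OPEN; NS regularity NOT proved.
-/

set_option linter.dupNamespace false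

namespace Summit.NavierStokesRegularity.NavierStokesRegularity.Cruxes.PoloidalLiouville.CentreJet

open Set Function
open Literature.Analysis.FluidPDE (cross curl rotZ swirl IsClassicalNSSolutionOn)
open Literature.Analysis.FluidPDE.VectorCalculus (IsDivFree)

/-- ℝ³. -/
abbrev E3 : Type := EuclideanSpace ℝ (Fin 3)

/-- `V` is unthreaded about `x₀`: its vortex lines lie on the spheres about `x₀` (1222's hypothesis, frozen time). -/
def IsUnthreadedAbout (x₀ : E3) (V : E3 → E3) : Prop :=
  ∀ x, inner ℝ (x - x₀) (curl V x) = 0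

/-- Classical steady Navier–Stokes on an open set `U` (`ν = 1`, no force): `(V·∇)V + ∇p = ΔV`, `div V = 0` on `U`. -/
def IsSteadyNSOn (U : Set E3) (V : E3 → E3) (p : E3 → ℝ) : Prop :=
  ContDiffOn ℝ 3 V U ∧ ContDiffOn ℝ 1 p U ∧ (∀ x ∈ U, Literature.Analysis.FluidPDE.VectorCalculus.divergence V x = 0) ∧
    ∀ x ∈ U, fderiv ℝ V x (V x) + gradient p x = Laplacian.laplacian V x

/-! ## Degree ≤ 2 of the sieve: unconditional centre laws (S-sized) -/

/-- (E1, S — kinematics of the centre) If `V ∈ C³` is unthreaded about `x₀` then at the centre the vorticity VANISHES,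
its gradient is SKEW (`∇ω(x₀) y = c × y`, `c = ½ curl ω (x₀)`), and its Laplacian vanishes: orders 1, 2, 3 of
`⟪y, ω(x₀ + y)⟫ ≡ 0` (`Δ(⟪y, ω₂(y)⟫) = 2 div ω₂ + ⟪y, Δω₂⟫`). -/
def CentreVorticityJet : Prop :=
  ∀ (V : E3 → E3) (x₀ : E3), ContDiff ℝ 3 V → IsUnthreadedAbout x₀ V →
    curl V x₀ = 0 ∧ (∀ y : E3, inner ℝ y (fderiv ℝ (curl V) x₀ y) = 0) ∧ Laplacian.laplacian (curl V) x₀ = 0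

/-- (E2, S — the degree-1 law, NEW) **Centre drift law.** For a classical steady Navier–Stokes flow on `ℝ³` unthreaded about
`x₀`: `V(x₀) × ΔV(x₀) = 0` — the velocity at the centre is parallel to `curl ω = −ΔV` there (equivalently
`∇ω(x₀) · V(x₀) = 0`).  Proof: vorticity equation at `x₀` with E1: `(V·∇)ω = (ω·∇)V + Δω = 0` at `x₀`, and
`(V·∇)ω(x₀) = c × V(x₀)`, `c = ½ curl curl V (x₀) = −½ ΔV(x₀)` (`div V = 0`).  It is the degree-1 component `b × c = 0`
of the loop law and survives for unthreaded EVOLUTIONS (`∂ₜω(x₀) = 0`): `CentreDriftLawEvolution`. -/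
def CentreDriftLaw : Prop :=
  ∀ (V : E3 → E3) (p : E3 → ℝ) (x₀ : E3), IsSteadyNSOn univ V p → IsUnthreadedAbout x₀ V →
    cross (V x₀) (Laplacian.laplacian V x₀) = 0

/-- (E2′, S) The same law along an unthreaded classical EVOLUTION (`ν = 1`, no force) on `[t₀, t₁)`. -/
def CentreDriftLawEvolution : Prop :=
  ∀ (u : ℝ → E3 → E3) (p : ℝ → E3 → ℝ) (x₀ : E3) (t₀ t₁ : ℝ), t₀ < t₁ →
    IsClassicalNSSolutionOn (Ico t₀ t₁) 1 0 u p → (∀ t ∈ Ico t₀ t₁, IsUnthreadedAbout x₀ (u t)) →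
    ∀ t ∈ Ico t₀ t₁, cross (u t x₀) (Laplacian.laplacian (u t) x₀) = 0

/-- (E3, S — finite-dimensional algebra behind the degree-2 law) If `c ≠ 0` and `M` is a symmetric endomorphism of `ℝ³`
with `det(y, c, My) = 0` for all `y`, then `M` is ZONAL about `c`: `M = λ·𝟙 + μ·c ⊗ c`.  Applied to
`M = sym ∇V(x₀) − β·Q` (`P₂ = 2 det(y, c, (S − βQ)y)`, `Q` the quadratic toroidal potential `T₂(y) = ⟪y, Qy⟫`,
`V(x₀) = β c/‖c‖`): the strain at the centre is slaved to the (free, possibly non-zonal) quadratic vorticity datum. -/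
def CentreStrainLawAlgebra : Prop :=
  ∀ (c : E3) (M : E3 →L[ℝ] E3), c ≠ 0 → (∀ a b : E3, inner ℝ (M a) b = inner ℝ a (M b)) →
    (∀ y : E3, inner ℝ y (cross c (M y)) = 0) →
    ∃ l μ : ℝ, ∀ y : E3, M y = l • y + (μ * inner ℝ c y) • c

/-! ## The reduction: on the steady stratum the loop law is everything -/

/-- (E4, S — Poincaré lemma) **Poloidal velocity representation.** A `C²` divergence-free field with toroidal-exact
vorticity `curl V = ∇T × (x − x₀)` off `x₀` is `V = T·(x − x₀) + ∇φ` off `x₀` (`curl (T y) = ∇T × y`, and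
`ℝ³ ∖ {x₀}` is simply connected); `div V = 0` is exactly the last clause `Δφ = −(3 + (x − x₀)·∇)T` (v1.3: clause added,
V17-P4). -/
def PoloidalRepresentation : Prop :=
  ∀ (V : E3 → E3) (T : E3 → ℝ) (x₀ : E3), ContDiff ℝ 2 V → IsDivFree V → ContDiffOn ℝ 2 T {x₀}ᶜ →
    (∀ x, x ≠ x₀ → curl V x = cross (gradient T x) (x - x₀)) →
    ∃ φ : E3 → ℝ, ContDiffOn ℝ 2 φ {x₀}ᶜ ∧ (∀ x, x ≠ x₀ → V x = T x • (x - x₀) + gradient φ x) ∧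
      ∀ x, x ≠ x₀ → Laplacian.laplacian φ x = -(3 * T x + inner ℝ (x - x₀) (gradient T x))

/-- (E5, S — the steady vorticity equation in toroidal form) **Steady slaving identity.** For a classical steady flow on
`ℝ³` with `curl V = ∇T × (x − x₀)` off `x₀`, `T ∈ C⁴` off `x₀`: `∇(ΔT) × (x − x₀) = curl (curl V × V)` off `x₀`
(`Δ curl V = curl ΔV = curl((V·∇)V) = curl(ω × V)` and `Δ(∇T × y) = ∇(ΔT) × y`).  With the loop law (automatic when steady:
`⟪y, curl(ω × V)⟫ = ⟪y, Δω⟫ = Δ⟪y, ω⟫ − 2 div ω = 0`) this is the WHOLE steady system for the data `(T, φ)`. -/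
def SteadySlavingIdentity : Prop :=
  ∀ (V : E3 → E3) (p : E3 → ℝ) (T : E3 → ℝ) (x₀ : E3), IsSteadyNSOn univ V p → ContDiff ℝ 4 V → ContDiffOn ℝ 4 T {x₀}ᶜ →
    (∀ x, x ≠ x₀ → curl V x = cross (gradient T x) (x - x₀)) →
    ∀ x, x ≠ x₀ →
      cross (gradient (fun z => Laplacian.laplacian T z) x) (x - x₀) = curl (fun z => cross (curl V z) (V z)) x

/-! ## The conjecture the sieve points at, and what it buys on W1's steady stratum -/

/-- (C1, CONJECTURE — local algebraic rigidity at a type-N centre) **Steady local rigidity (N).** A real-analytic steady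
Navier–Stokes flow on a ball, unthreaded about the centre `x₀`, with `ΔV(x₀) ≠ 0` (type N: the vorticity gradient at the
centre is non-zero), is AXISYMMETRIC WITHOUT SWIRL on that ball about the axis through `x₀` spanned by `ΔV(x₀)`:
after an isometric change of frame `g` (with `g e₃ ∥ ΔV(x₀)`), `W y := g⁻¹ V(x₀ + g y)` commutes with the rotations `rotZ θ`
and has zero swirl.  Evidence: the exact linearised sieve (mode `m` dies by degree `m + 4`, K ≤ 8, all tested strata) and
the window lemma; OPEN part: non-perturbative non-zonal 5-jets.  FALSE if "type N" is dropped: potential flows, and the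
formal pure-strain family `T₂ = λ⟪y, Sy⟫` at a degenerate stagnation centre. -/
def SteadyLocalRigidityN : Prop :=
  ∀ (V : E3 → E3) (p : E3 → ℝ) (x₀ : E3) (ρ : ℝ), 0 < ρ →
    AnalyticOnNhd ℝ V (Metric.ball x₀ ρ) → AnalyticOnNhd ℝ p (Metric.ball x₀ ρ) →
    IsSteadyNSOn (Metric.ball x₀ ρ) V p → (∀ x ∈ Metric.ball x₀ ρ, inner ℝ (x - x₀) (curl V x) = 0) →
    Laplacian.laplacian V x₀ ≠ 0 →
    ∃ g : E3 ≃ₗᵢ[ℝ] E3, (∃ a : ℝ, g (EuclideanSpace.single (2 : Fin 3) (1 : ℝ)) = a • Laplacian.laplacian V x₀) ∧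
      (∀ θ : ℝ, ∀ y : E3, ‖y‖ < ρ → g.symm (V (x₀ + g (rotZ θ y))) = rotZ θ (g.symm (V (x₀ + g y)))) ∧
      ∀ y : E3, ‖y‖ < ρ → swirl (fun z => g.symm (V (x₀ + g z))) y = 0

/-- (R1, the TARGET RUNG on W1's steady stratum — OPEN, strictly weaker than `SteadyPoloidalLiouville`) **No type-N centre.**
A bounded classical steady Navier–Stokes flow on `ℝ³` unthreaded about `x₀` has `ΔV(x₀) = 0` (equivalently
`curl curl V (x₀) = 0`: the toroidal potential starts at degree ≥ 2 at the centre).  Killable: any bounded steady unthreaded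
flow with `ΔV(x₀) ≠ 0` refutes it. -/
def NoTypeNCentre : Prop :=
  ∀ (V : E3 → E3) (p : E3 → ℝ) (x₀ : E3), IsSteadyNSOn univ V p → (∃ B : ℝ, ∀ x, ‖V x‖ ≤ B) →
    IsUnthreadedAbout x₀ V → Laplacian.laplacian V x₀ = 0

/-- (F1, LITERATURE FACT to port, M — Masuda 1967 Proc. Japan Acad. 43, 827–832, Thm 1; Kahane 1969 Arch. Rational Mech.
Anal. 33, 386–405) **Steady Navier–Stokes solutions are real-analytic in space.**  Stated for the classical notion used in
this file (`V ∈ C³`, `p ∈ C¹` on an open set). -/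
def SteadyNSAnalytic : Prop :=
  ∀ (U : Set E3) (V : E3 → E3) (p : E3 → ℝ), IsOpen U → IsSteadyNSOn U V p → AnalyticOnNhd ℝ V U ∧ AnalyticOnNhd ℝ p U

/-- (F2, LITERATURE-GRADE FACT, M — uniform interior estimates for bounded steady solutions: scaling-invariant local
regularity on unit balls, e.g. Seregin 2014 (book) Ch. 6 / Tsai 2018 (book) Ch. 5; to be ported or proved) **Gradient
bounds.**  A bounded classical steady Navier–Stokes flow on `ℝ³` has globally bounded `∇V`, `∇p` and `ΔV`. -/
def SteadyNSGradientBounds : Prop :=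
  ∀ (V : E3 → E3) (p : E3 → ℝ), IsSteadyNSOn univ V p → (∃ B : ℝ, ∀ x, ‖V x‖ ≤ B) →
    ∃ C : ℝ, ∀ x, ‖fderiv ℝ V x‖ ≤ C ∧ ‖gradient p x‖ ≤ C ∧ ‖Laplacian.laplacian V x‖ ≤ C

/-- (G1, GLUE, M — the class bridge V17-P1(ii): with `∇p` bounded the pressure has linear growth, the Gaussian-tested weak
form of the steady equation holds, and the constant-in-time field satisfies the Oseen-kernel Duhamel identity that DEFINES
the tree's bounded ancient mild class; uniqueness side via `Literature.Analysis.FluidPDE.oseenMild_bounded_unique`)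
**Bounded classical steady ⇒ bounded ancient mild (ν = 1).** -/
def SteadyClassicalIsMild : Prop :=
  ∀ (V : E3 → E3) (p : E3 → ℝ), IsSteadyNSOn univ V p → (∃ B : ℝ, ∀ x, ‖V x‖ ≤ B) →
    (∃ C : ℝ, ∀ x, ‖fderiv ℝ V x‖ ≤ C ∧ ‖gradient p x‖ ≤ C) →
    Literature.Analysis.FluidPDE.IsBoundedAncientMildSolution 1 (fun _ : ℝ => V)

/-- (R2, REDUCTION, M⁺ over the typed facts F1, F2, G1 — v1.3, V17-P1) `SteadyLocalRigidityN` closes the type-N case of the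
steady stratum:
steady classical flows are real-analytic (interior regularity, a Literature fact to cite), local axisymmetry-without-swirl
propagates to all of `ℝ³` (the rotated flow is a steady solution agreeing on a ball), and a BOUNDED axisymmetric no-swirl
steady flow is constant (KNSS 2009 Thm 5.2, tree fact `Literature.Analysis.FluidPDE.knss_axisymmetric_no_swirl'_holds`
applied to the constant-in-time ancient solution) — but a constant flow has `ΔV = 0`, contradiction.  So, given C1, a
bounded steady counterexample to 1222 must have a DEGENERATE centre.  Inside the M⁺ proof (not separate items): Euclidean
covariance of `IsSteadyNSOn` / of the mild class under the rigid motion `y ↦ x₀ + g y` (S), and analytic continuation of the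
symmetry identities from the ball to `ℝ³` (S, `AnalyticOnNhd.eqOn_of_preconnected_of_eventuallyEq`). -/
def NoTypeNCentreOfRigidity : Prop :=
  SteadyNSAnalytic → SteadyNSGradientBounds → SteadyClassicalIsMild → SteadyLocalRigidityN → NoTypeNCentre

/-- (C1*, CONJECTURE, XL — v1.2; the MASTER local statement: C1 without the type-N hypothesis, potential flows
excluded instead) **Steady local rigidity at every centre type.**  A real-analytic steady Navier–Stokes flow on a ball,
unthreaded about the centre `x₀`, whose vorticity does not vanish identically on the ball, is AXISYMMETRIC WITHOUT SWIRL
about some axis through `x₀`.  Evidence (`CentreJetSieve-RESULTS.md` §3b/§5, exact over ℚ): (i) the UNIFIED LINEARISED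
SIEVE around generic axisymmetric no-swirl base germs is gauge-exact at every centre type tested — type N and
drift-dominated degenerate centres: all non-zonal data of degree ≤ K−4 forced (mode m dies by degree m+4, K ≤ 11);
axisymmetric-strain / quadratic-vorticity degenerate centres: surviving space of degree ≤ K−2 data = exactly the
2-dimensional tilt gauge (K ≤ 10); cubic-onset centres: same with window K−3; potential bases: every non-zonal toroidal
perturbation dies; (ii) the one genuinely non-axisymmetric nonlinear family found (triaxial polhode germs) is
obstructed at degree 11 (`NoTriaxialPolhodeCentre`; λ = 0 ⇒ potential germ, `TriaxialToroidalJetRigidity`), and the generic-point nonlinear sieve (§5b) kills the cubic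
polhode class at degree 10 (34 leftover conditions), the zero-strain triaxial quadratic-vorticity class at degree 9 (21)
and incompatible leading pairs at degree 4.  UNTESTED: onsets of degree ≥ 4, mixed classes, tuned measure-zero
subvarieties.  FALSE without the vorticity hypothesis (non-axisymmetric potential flows). -/
def SteadyLocalRigidity : Prop :=
  ∀ (V : E3 → E3) (p : E3 → ℝ) (x₀ : E3) (ρ : ℝ), 0 < ρ →
    AnalyticOnNhd ℝ V (Metric.ball x₀ ρ) → AnalyticOnNhd ℝ p (Metric.ball x₀ ρ) →
    IsSteadyNSOn (Metric.ball x₀ ρ) V p → (∀ x ∈ Metric.ball x₀ ρ, inner ℝ (x - x₀) (curl V x) = 0) →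
    (∃ x ∈ Metric.ball x₀ ρ, curl V x ≠ 0) →
    ∃ g : E3 ≃ₗᵢ[ℝ] E3,
      (∀ θ : ℝ, ∀ y : E3, ‖y‖ < ρ → g.symm (V (x₀ + g (rotZ θ y))) = rotZ θ (g.symm (V (x₀ + g y)))) ∧
      ∀ y : E3, ‖y‖ < ρ → swirl (fun z => g.symm (V (x₀ + g z))) y = 0

/-- (C1″, CONJECTURE, L — v1.3 = the V17-P5 repair of v1.1's `NoTriaxialStagnationCentre`, which was FALSE AS TYPED:
ns-wall-crit-1's witness is the pure strain flow `V = S(x − x₀)`, `p = −‖S(x − x₀)‖²/2` — steady, analytic, irrotational hence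
unthreaded, triaxial, all hypotheses met, conclusion `False`; every harmonic potential flow with a triaxial critical point
likewise.  The missing hypothesis is `λ ≠ 0`: the TOROIDAL 2-JET `curl V = 2λ S(x−x₀) × (x−x₀) + O(|x−x₀|³)` must not vanish,
typed as the second derivative of `curl V` at `x₀` being non-zero.)  **No triaxial polhode centre.**  A real-analytic steady
Navier–Stokes flow on a ball, unthreaded about the centre `x₀`, with `V(x₀) = 0`, `ΔV(x₀) = 0`, three DISTINCT principal
strains at `x₀`, and non-vanishing toroidal 2-jet, does not exist.  Evidence (POLHODE SIEVE, RESULTS §5, exact over ℚ, λ ≠ 0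
throughout): `T₂ = λ⟪y,Sy⟫` forced (vortex lines = polhodes), γ₃ dies at degree 6, γ₅ at 8, γ₄ ↦ a line at 7, γ₆ + one
quadratic branch condition at 9, and at degree 11 γ₈ is pinned and FOUR non-zero conditions remain on (λ, shape of S), at
S = diag(1,2,−3), λ ∈ {1/3,1,2} and S = diag(1,3,−4), λ = 1.  OPEN: the exact resultant over (λ, S).  NOT claimed for two equal
principal strains. -/
def NoTriaxialPolhodeCentre : Prop :=
  ∀ (V : E3 → E3) (p : E3 → ℝ) (x₀ : E3) (ρ : ℝ), 0 < ρ →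
    AnalyticOnNhd ℝ V (Metric.ball x₀ ρ) → AnalyticOnNhd ℝ p (Metric.ball x₀ ρ) →
    IsSteadyNSOn (Metric.ball x₀ ρ) V p → (∀ x ∈ Metric.ball x₀ ρ, inner ℝ (x - x₀) (curl V x) = 0) →
    V x₀ = 0 → Laplacian.laplacian V x₀ = 0 →
    (∃ (u : Fin 3 → E3) (e : Fin 3 → ℝ), Orthonormal ℝ u ∧ Function.Injective e ∧ ∀ i, fderiv ℝ V x₀ (u i) = e i • u i) →
    fderiv ℝ (fderiv ℝ (curl V)) x₀ ≠ 0 →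
    False

/-! ## Algebra of the `λ = 0` cell (v1.3b): the two lemmas that PROVE L1 on paper (RESULTS §5c)
About the pure-strain base `V = S y` (`T ≡ 0`, `m = ⟪y,Sy⟫ =: s`) the loop law at the LOWEST non-zero toroidal degree `n ≥ 3`
is EXACTLY linear: `P_{n+1} = det(y, ∇h_n, ∇s) = 2 ⟪∇h_n, W⟫`, `W(y) = y × S y` the Euler-top (polhode) field — every other
term needs `m_j^{pert}` with `j ≤ 2`, i.e. the drift `V(x₀)` (zero) or a strain perturbation (absorbed into `S`).  So `h_n` is a
polynomial FIRST INTEGRAL of the Euler top (A1 ⇒ `h_n ∈ ℝ[|y|², s]`) that is harmonic (A2 ⇒ `n ≤ 2`): contradiction, `T ≡ 0`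
formally, `curl V ≡ 0` by analyticity.  Both lemmas verified exactly for degrees ≤ 8 and four spectra (`engine/check_lemmaAB.py`);
paper proofs: A1 — split `T` by parity under the sign flips `yᵢ ↦ −yᵢ` (each maps `W ↦ −W`), write the class-`ε` part as
`y^ε F(y₁²,y₂²,y₃²)`; then `W·∇(y^ε F) = y^ε y₁y₂y₃ (2 D F + Σ εᵢ cᵢ F/uᵢ)`, `D = Σ cᵢ ∂_{uᵢ}`, `c = (a₃−a₂, a₁−a₃, a₂−a₁)`, all
`cᵢ ≠ 0`; for `ε = 0`, `D F = 0` ⇔ `F ∈ ℝ[ℓ₁, ℓ₂]` with `ℓ₁ = Σuᵢ = |y|²`, `ℓ₂ = Σ aᵢuᵢ = s` (the two linear forms killed by `D`);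
for `ε ≠ 0`, `F² Π_{εᵢ=1} uᵢ` would be `D`-invariant yet vanish on the hyperplane `uᵢ = 0` transversal to `D` — so `F = 0`.
A2 — in the coordinates `(ρ, s, q)`, `q = |Sy|²` (independent of `ρ, s` by Vandermonde), `Δ F(ρ,s) = 4ρF_ρρ + 8sF_ρs + 6F_ρ + 4qF_ss`,
so `F_ss = 0` and then `F = a + b s`. -/

open MvPolynomial in
/-- `|y|²` as a polynomial in three variables. -/
noncomputable def rhoPoly : MvPolynomial (Fin 3) ℝ := ∑ i : Fin 3, X i ^ 2

open MvPolynomial in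
/-- `⟪y, S y⟫`, `S = diag a`, as a polynomial. -/
noncomputable def strainPoly (a : Fin 3 → ℝ) : MvPolynomial (Fin 3) ℝ := ∑ i : Fin 3, C (a i) * X i ^ 2

open MvPolynomial in
/-- The Euler-top (polhode) vector field `W(y) = y × S y`, `S = diag a`, componentwise as polynomials. -/
noncomputable def eulerTopField (a : Fin 3 → ℝ) : Fin 3 → MvPolynomial (Fin 3) ℝ :=
  ![C (a 2 - a 1) * X 1 * X 2, C (a 0 - a 2) * X 0 * X 2, C (a 1 - a 0) * X 0 * X 1]

open MvPolynomial in
/-- (kernel-checked guard) `|y|²` is a first integral of the typed Euler-top field. -/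
theorem eulerTop_rho (a : Fin 3 → ℝ) : ∑ i : Fin 3, eulerTopField a i * pderiv i rhoPoly = 0 := by
  simp only [eulerTopField, rhoPoly, Fin.sum_univ_three, map_add]
  simp only [pderiv_X, Matrix.cons_val_zero, Matrix.cons_val_one, Matrix.head_cons, Matrix.cons_val_two,
    Matrix.tail_cons, Derivation.leibniz_pow]
  simp
  ring

open MvPolynomial in
/-- (kernel-checked guard) `⟪y, S y⟫` is a first integral of the typed Euler-top field (so `ℝ[|y|², ⟪y,Sy⟫] ⊆ ker W·∇`;
A1 is the converse). -/
theorem eulerTop_strain (a : Fin 3 → ℝ) : ∑ i : Fin 3, eulerTopField a i * pderiv i (strainPoly a) = 0 := by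
  simp only [eulerTopField, strainPoly, Fin.sum_univ_three, map_add, Derivation.leibniz, pderiv_C]
  simp only [pderiv_X, Matrix.cons_val_zero, Matrix.cons_val_one, Matrix.head_cons, Matrix.cons_val_two,
    Matrix.tail_cons, Derivation.leibniz_pow]
  simp
  ring

open MvPolynomial in
/-- (A1, S/M — ALGEBRA, all degrees, PROVED ON PAPER; classical background: the Euler–Poinsot top has the two quadratic
integrals `|y|²`, `⟪y,Sy⟫` [Arnold 1989 §29]) **Polynomial first integrals of the Euler top.**  For pairwise distinct `aᵢ`,
a real polynomial annihilated by the derivation `W·∇` is a polynomial in `|y|²` and `⟪y, S y⟫`. -/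
def EulerTopFirstIntegrals : Prop :=
  ∀ a : Fin 3 → ℝ, Function.Injective a → ∀ T : MvPolynomial (Fin 3) ℝ,
    (∑ i : Fin 3, eulerTopField a i * pderiv i T = 0) →
    ∃ F : MvPolynomial (Fin 2) ℝ, T = aeval ![rhoPoly, strainPoly a] F

open MvPolynomial in
/-- (A2, S — ALGEBRA, PROVED ON PAPER) **No harmonic polhode invariant beyond degree 2.**  For pairwise distinct `aᵢ` with
`Σ aᵢ = 0` (the strain of a divergence-free field is traceless; without it the degree-2 invariant is `s − (tr S/3)|y|²` instead of `s`),
if `F(|y|², ⟪y,Sy⟫)` is (formally) harmonic then `F = c₀ + c₁·s`.  With A1: the bracket `{·, ⟪y,Sy⟫}` is injective on harmonic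
`n`-forms for every `n ≥ 3` (the rank table `2n+1`, `3 ≤ n ≤ 11`, of v1.3 is now a lemma for all `n`). -/
def NoHarmonicPolhodeInvariant : Prop :=
  ∀ a : Fin 3 → ℝ, Function.Injective a → ∑ i, a i = 0 → ∀ F : MvPolynomial (Fin 2) ℝ,
    (∑ i : Fin 3, pderiv i (pderiv i (aeval ![rhoPoly, strainPoly a] F)) = 0) →
    ∃ c₀ c₁ : ℝ, F = C c₀ + C c₁ * X 1

/-- (L1, LEMMA — PROVED ON PAPER in v1.3b from A1 + A2 + the lowest-degree exactness above; formalisation M: needs the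
formal version of E4, `steady ⇒ loop law` from E5, and analytic bookkeeping; v1.3 answered the critic's «λ = 0, ω = O(|y|³)» cell
with a rank table, v1.3b with a proof) **Triaxial toroidal-jet rigidity.**  In
the setting of C1″ but with VANISHING toroidal 2-jet (`λ = 0`), the vorticity vanishes identically near `x₀` (the germ is a
potential flow).  Mechanism: with `T₂ = 0` and `T_j = 0` for `j < n`, the loop law at degree `n+1` reads `{h_n, ⟪y,Sy⟫} = 0`, and
the bracket `X = {·, ⟪y,Sy⟫} = 2 W·∇` is INJECTIVE on harmonic `n`-forms for `n ≥ 3` when `S` is triaxial (A1 + A2; engine: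
rank `2n+1` for `3 ≤ n ≤ 11`) ⇒ `T ≡ 0` formally ⇒ `curl V ≡ 0` by analyticity. -/
def TriaxialToroidalJetRigidity : Prop :=
  ∀ (V : E3 → E3) (p : E3 → ℝ) (x₀ : E3) (ρ : ℝ), 0 < ρ →
    AnalyticOnNhd ℝ V (Metric.ball x₀ ρ) → AnalyticOnNhd ℝ p (Metric.ball x₀ ρ) →
    IsSteadyNSOn (Metric.ball x₀ ρ) V p → (∀ x ∈ Metric.ball x₀ ρ, inner ℝ (x - x₀) (curl V x) = 0) →
    V x₀ = 0 → Laplacian.laplacian V x₀ = 0 →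
    (∃ (u : Fin 3 → E3) (e : Fin 3 → ℝ), Orthonormal ℝ u ∧ Function.Injective e ∧ ∀ i, fderiv ℝ V x₀ (u i) = e i • u i) →
    fderiv ℝ (fderiv ℝ (curl V)) x₀ = 0 →
    ∀ x ∈ Metric.ball x₀ ρ, curl V x = 0

/-- (C1″∃, the form C1* consumes: «some vorticity on the ball» instead of «λ ≠ 0»; = C1″ + L1, S glue
`NoTriaxialVorticalCentreOfJet`) -/
def NoTriaxialVorticalCentre : Prop :=
  ∀ (V : E3 → E3) (p : E3 → ℝ) (x₀ : E3) (ρ : ℝ), 0 < ρ →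
    AnalyticOnNhd ℝ V (Metric.ball x₀ ρ) → AnalyticOnNhd ℝ p (Metric.ball x₀ ρ) →
    IsSteadyNSOn (Metric.ball x₀ ρ) V p → (∀ x ∈ Metric.ball x₀ ρ, inner ℝ (x - x₀) (curl V x) = 0) →
    V x₀ = 0 → Laplacian.laplacian V x₀ = 0 →
    (∃ (u : Fin 3 → E3) (e : Fin 3 → ℝ), Orthonormal ℝ u ∧ Function.Injective e ∧ ∀ i, fderiv ℝ V x₀ (u i) = e i • u i) →
    (∃ x ∈ Metric.ball x₀ ρ, curl V x ≠ 0) →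
    False

/-- (S glue) C1″ and L1 give the ∃-form. -/
theorem noTriaxialVorticalCentre_of (h₁ : NoTriaxialPolhodeCentre) (h₂ : TriaxialToroidalJetRigidity) :
    NoTriaxialVorticalCentre := by
  intro V p x₀ ρ hρ hV hp hNS hU h0 hΔ hS hω
  by_cases hl : fderiv ℝ (fderiv ℝ (curl V)) x₀ = 0
  · obtain ⟨x, hx, hne⟩ := hω
    exact hne (h₂ V p x₀ ρ hρ hV hp hNS hU h0 hΔ hS hl x hx)
  · exact h₁ V p x₀ ρ hρ hV hp hNS hU h0 hΔ hS hl

/-- (R3, S — the degenerate tail's trivial piece) If the vorticity of a bounded classical steady flow vanishes identically,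
the flow is constant (`V = ∇φ`, `φ` harmonic with bounded gradient; Liouville). -/
def IrrotationalSteadyLiouville : Prop :=
  ∀ (V : E3 → E3) (p : E3 → ℝ), IsSteadyNSOn univ V p → (∃ B : ℝ, ∀ x, ‖V x‖ ≤ B) → (∀ x, curl V x = 0) →
    ∃ b : E3, ∀ x, V x = b

/-- (W1ˢ, the TARGET of this card = the steady stratum of 1222 in classical form; g4's
`Precession.SteadyPoloidalLiouvilleW1` is the same statement inside the bounded-ancient-mild class — OPEN, nothing here
proves it) **Bounded steady unthreaded Liouville.**  A bounded classical steady Navier–Stokes flow on `ℝ³` whose vortex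
lines lie on the spheres about some `x₀` is constant. -/
def SteadyUnthreadedLiouville : Prop :=
  ∀ (V : E3 → E3) (p : E3 → ℝ) (x₀ : E3), IsSteadyNSOn univ V p → (∃ B : ℝ, ∀ x, ‖V x‖ ≤ B) →
    IsUnthreadedAbout x₀ V → ∃ b : E3, ∀ x, V x = b

/-- (S, V17-P4 — R1 sits literally below the steady-stratum statement) `SteadyUnthreadedLiouville` gives R1: a constant
field has `ΔV = 0` (no class bridge needed in the classical form; g4's mild-class H₂ `Precession.SteadyPoloidalLiouville`
gives it through F2 + G1). -/
theorem noTypeNCentre_of_steadyUnthreadedLiouville (h : SteadyUnthreadedLiouville) : NoTypeNCentre := by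
  intro V p x₀ hNS hB hU
  obtain ⟨b, hb⟩ := h V p x₀ hNS hB hU
  have hV : V = fun _ => b := funext hb
  subst hV
  exact congrFun (InnerProductSpace.laplacian_const (E := E3) (c := b)) x₀

/-- (R2*, REDUCTION, M⁺ over F1, F2, G1; v1.2/v1.3) C1* closes the WHOLE steady stratum: a bounded classical
steady flow is real-analytic (F1); if its vorticity vanishes near `x₀` it
vanishes identically (analytic continuation) and R3 gives constancy; otherwise C1* makes it axisymmetric without swirl
on a ball, the symmetry propagates to `ℝ³` (analyticity), and KNSS 2009 Thm 5.2 (tree fact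
`Literature.Analysis.FluidPDE.knss_axisymmetric_no_swirl'_holds`, constant-in-time ancient solution) gives constancy. -/
def SteadyStratumOfRigidity : Prop :=
  SteadyNSAnalytic → SteadyNSGradientBounds → SteadyClassicalIsMild →
    SteadyLocalRigidity → IrrotationalSteadyLiouville → SteadyUnthreadedLiouville

/-- (R2♮, REDUCTION, PROVED in dev by ns-wall-eng-7 g5 — v1.4 wording agreed with ns-wall-crit-1 g3 01:17:15Z; closed here BY NAME
once `Theorems/ThreadingFluxCentreJetRigidityReductionSharp.lean` lands, and ALREADY closed below modulo F1 from the landed R2*, F2,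
G1, R3) **The steady stratum stands or falls with C1* alone.** -/
def SteadyStratumOfRigiditySharp : Prop :=
  SteadyLocalRigidity → SteadyUnthreadedLiouville

/-- (R2♮-N, REDUCTION, same status as R2♮) **The type-N steady case stands or falls with C1 alone.** -/
def NoTypeNCentreOfRigiditySharp : Prop :=
  SteadyLocalRigidityN → NoTypeNCentre

/-! ## Sanity (S): the laws are consistent with the axisymmetric family -/

/-- The zonal endomorphism `λ·𝟙 + μ·c ⊗ c` does satisfy `det(y, c, My) = 0` (converse direction of E3; `simp`-level once
`cross` is unfolded — recorded as a Prop, not proved here). -/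
def ZonalSatisfiesStrainLaw : Prop :=
  ∀ (c y : E3) (l μ : ℝ), inner ℝ y (cross c (l • y + (μ * inner ℝ c y) • c)) = 0

/-! ## By-name kernel closures (v1.3c/e): the S items E1, E2, E2′, E3, E5, R3 and the sanity item are THEOREMS in the tree
(ns-wall-eng-7 g4: Defs twin `Theorems/ThreadingFluxCentreJetDefs.lean` p679179 with verbatim bodies, proofs in
`ThreadingFluxCentreJetVorticityJet.lean` (E1), `…StrainLaw.lean` (E3), `…FirstLemmas.lean` (R3, sanity)).  The `Iff.rfl`
guards certify the twin bodies are this sketch's; the `_holds` theorems close the sketch Props by the landed terms. -/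
section ByName
open Summit.NavierStokesRegularity.NavierStokesRegularity.Theorems.PoloidalLiouville

example : @IsUnthreadedAbout = @CentreJet.IsUnthreadedAbout := rfl
example : @IsSteadyNSOn = @CentreJet.IsSteadyNSOn := rfl
example : CentreVorticityJet ↔ CentreJet.CentreVorticityJet := Iff.rfl
example : CentreStrainLawAlgebra ↔ CentreJet.CentreStrainLawAlgebra := Iff.rfl
example : IrrotationalSteadyLiouville ↔ CentreJet.IrrotationalSteadyLiouville := Iff.rfl
example : ZonalSatisfiesStrainLaw ↔ CentreJet.ZonalSatisfiesStrainLaw := Iff.rfl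

/-- E1 holds (kernel, by name). -/
theorem centreVorticityJet_holds : CentreVorticityJet := CentreJet.centreVorticityJet
/-- E3 holds (kernel, by name). -/
theorem centreStrainLawAlgebra_holds : CentreStrainLawAlgebra := CentreJet.centreStrainLawAlgebra
/-- R3 holds (kernel, by name). -/
theorem irrotationalSteadyLiouville_holds : IrrotationalSteadyLiouville := CentreJet.irrotationalSteadyLiouville
/-- The sanity item holds (kernel, by name). -/
theorem zonalSatisfiesStrainLaw_holds : ZonalSatisfiesStrainLaw := CentreJet.zonalSatisfiesStrainLaw

example : CentreDriftLaw ↔ CentreJet.CentreDriftLaw := Iff.rfl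
example : CentreDriftLawEvolution ↔ CentreJet.CentreDriftLawEvolution := Iff.rfl
example : SteadySlavingIdentity ↔ CentreJet.SteadySlavingIdentity := Iff.rfl

/-- E2 holds (kernel, by name: eng-7 `ThreadingFluxCentreJetDriftLaw.lean`). -/
theorem centreDriftLaw_holds : CentreDriftLaw := CentreJet.centreDriftLaw
/-- E2′ holds (kernel, by name: eng-7 p680994). -/
theorem centreDriftLawEvolution_holds : CentreDriftLawEvolution := CentreJet.centreDriftLawEvolution
/-- E5 holds (kernel, by name: eng-7 `ThreadingFluxCentreJetSteadySlaving.lean`). -/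
theorem steadySlavingIdentity_holds : SteadySlavingIdentity := CentreJet.steadySlavingIdentity

/-- E4 holds (kernel, by name: ns-wall-eng-7 g5 `ThreadingFluxCentreJetPoloidalRepresentation.lean`, Poincaré lemma on
`ℝ³ ∖ {x₀}` by two star-shaped charts; critic pre-landing ✓ 00:51:34Z). -/
theorem poloidalRepresentation_holds : PoloidalRepresentation := CentreJet.poloidalRepresentation

/-! v1.3f (ns-idea-15 g6): twin guards for the Euler-top algebra objects A1/A2 appended to the Defs twin by ns-wall-eng-5 g5
(p684604): the tree's `CentreJet.rhoPoly` / `strainPoly` / `eulerTopField` / `EulerTopFirstIntegrals` / `NoHarmonicPolhodeInvariant`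
are definitionally this sketch's objects, so eng-5's A1/A2 proof files will close `EulerTopFirstIntegrals` /
`NoHarmonicPolhodeInvariant` here by `_holds` one-liners when they land. -/
example : rhoPoly = CentreJet.rhoPoly := rfl
example : @strainPoly = @CentreJet.strainPoly := rfl
example : @eulerTopField = @CentreJet.eulerTopField := rfl
example : EulerTopFirstIntegrals ↔ CentreJet.EulerTopFirstIntegrals := Iff.rfl
example : NoHarmonicPolhodeInvariant ↔ CentreJet.NoHarmonicPolhodeInvariant := Iff.rfl

/-- So R2* needs one hypothesis fewer: the steady stratum follows from F1, F2, G1 and the master conjecture C1* alone. -/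
theorem steadyUnthreadedLiouville_of (h : SteadyStratumOfRigidity) (hF1 : SteadyNSAnalytic) (hF2 : SteadyNSGradientBounds)
    (hG1 : SteadyClassicalIsMild) (hC : SteadyLocalRigidity) : SteadyUnthreadedLiouville :=
  h hF1 hF2 hG1 hC irrotationalSteadyLiouville_holds

/-! v1.4 (ns-idea-15 g6, 2026-08-29): ns-wall-eng-7 g5 landed `ThreadingFluxCentreJetRigidityReduction.lean` (R2, R2*: bodies
verbatim over the typed facts), `ThreadingFluxCentreJetSteadyFacts.lean` (F2, G1 PROVED) and ns-wall-eng-5 landed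
`ThreadingFluxCentreJetEulerTopIntegrals.lean` (A1 PROVED, by name over the Defs twin).  Kernel closures by name; the steady
stratum of the sieve now reduces to F1 (interior analyticity, literature-grade) and the conjecture C1* — nothing else. -/

/-- F2 holds (kernel, by name: eng-7 `…SteadyFacts`). -/
theorem steadyNSGradientBounds_holds : SteadyNSGradientBounds := CentreJet.steadyNSGradientBounds
/-- G1 holds (kernel, by name: eng-7 `…SteadyFacts`). -/
theorem steadyClassicalIsMild_holds : SteadyClassicalIsMild := CentreJet.steadyClassicalIsMild
/-- R2 holds (kernel, by name: eng-7 `…RigidityReduction`). -/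
theorem noTypeNCentreOfRigidity_holds : NoTypeNCentreOfRigidity := CentreJet.noTypeNCentreOfRigidity
/-- R2* holds (kernel, by name: eng-7 `…RigidityReduction`). -/
theorem steadyStratumOfRigidity_holds : SteadyStratumOfRigidity := CentreJet.steadyStratumOfRigidity
/-- A1 holds (kernel, by name: eng-5 `…EulerTopIntegrals`). -/
theorem eulerTopFirstIntegrals_holds : EulerTopFirstIntegrals := CentreJet.eulerTopFirstIntegrals

/-- R2♮ modulo F1 (kernel): given interior analyticity, the steady stratum follows from C1* alone. -/
theorem steadyStratumOfRigiditySharp_of_analytic (hF1 : SteadyNSAnalytic) : SteadyStratumOfRigiditySharp :=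
  fun hC => steadyStratumOfRigidity_holds hF1 steadyNSGradientBounds_holds steadyClassicalIsMild_holds hC
    irrotationalSteadyLiouville_holds

/-- R2♮-N modulo F1 (kernel): given interior analyticity, the type-N case follows from C1 alone. -/
theorem noTypeNCentreOfRigiditySharp_of_analytic (hF1 : SteadyNSAnalytic) : NoTypeNCentreOfRigiditySharp :=
  fun hC => noTypeNCentreOfRigidity_holds hF1 steadyNSGradientBounds_holds steadyClassicalIsMild_holds hC

/-! v1.5 (ns-idea-15 g7, 2026-08-29): BY NAME — A2 (eng-5 p686323 `ThreadingFluxCentreJetHarmonicPolhode.lean`) and the SHARP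
reductions R2♮ / R2♮-N (eng-7 p686553 `ThreadingFluxCentreJetRigidityReductionSharp.lean`; F1 discharged inside the tree file)
close `NoHarmonicPolhodeInvariant`, `SteadyStratumOfRigiditySharp`, `NoTypeNCentreOfRigiditySharp` (BY-NAME ✓ ns-wall-crit-1
01:52:21Z).  The master conjecture `SteadyLocalRigidity` (C1*) is now the ONLY open input of the steady stratum:
`steadyUnthreadedLiouville_of_steadyLocalRigidity' : SteadyLocalRigidity → SteadyUnthreadedLiouville`.  ⟨1222⟩ OPEN. -/

/-- A2 by name (eng-5 p686323). -/
theorem noHarmonicPolhodeInvariant_holds : NoHarmonicPolhodeInvariant := CentreJet.noHarmonicPolhodeInvariant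

/-- R2♮ by name (eng-7 p686553): the steady stratum follows from C1* alone, unconditionally in F1. -/
theorem steadyStratumOfRigiditySharp_holds : SteadyStratumOfRigiditySharp :=
  CentreJet.steadyUnthreadedLiouville_of_steadyLocalRigidity

/-- R2♮-N by name (eng-7 p686553). -/
theorem noTypeNCentreOfRigiditySharp_holds : NoTypeNCentreOfRigiditySharp :=
  CentreJet.noTypeNCentre_of_steadyLocalRigidityN

/-- The steady stratum from the master conjecture C1* ALONE (v1.5; v1.4 needed F1 too). -/
theorem steadyUnthreadedLiouville_of_steadyLocalRigidity' (hC : SteadyLocalRigidity) : SteadyUnthreadedLiouville :=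
  steadyStratumOfRigiditySharp_holds hC

/-- The steady stratum from F1 and C1* (two hypotheses; v1.3f needed five). -/
theorem steadyUnthreadedLiouville_of' (hF1 : SteadyNSAnalytic) (hC : SteadyLocalRigidity) : SteadyUnthreadedLiouville :=
  steadyStratumOfRigiditySharp_of_analytic hF1 hC

end ByName

end Summit.NavierStokesRegularity.NavierStokesRegularity.Cruxes.PoloidalLiouville.CentreJet
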